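import Summits.Schanuel.Schanuel.Theorems.RootDecomp1KHyper26

/-!
# RootDecomp1KHyper — part 28: lens 6, gen 15 ADDENDUM «EXP-LATTICE-ANCHORED CELL» — PORT NOTE (census-1 gen 14, 2026-08-31): port of HOME/decomp-schanuel-lens-6/g15/ExpAnchorT.lean (sha256 88910796dcebd2172fc1140a7a26cfffe4565f54b7725ee24c7fee13d574cc8b, 2341 l; critic VERDICT L1568 (e) PORT GO, ACK L1571; CENSUS-REQUEST STATUS L1561) in eight chained parts `RootDecomp1KHyper28`–`35` (tools HOME/census/tools/gen14/port/); import switched to `RootDecomp1KHyper26`, the verbatim plane-lemma copy dropped; statements/proofs verbatim, 55 docstrings added, 7 one-liners `private`; `--supports stmt-Schanuel-33363`; rung 0. The lens's header follows.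

# ExpAnchor — lens 6, gen 15 (addendum): the EXPONENTIAL-LATTICE-ANCHORED cells of the level-3 span residual

(PORT-READY VARIANT `ExpAnchorT.lean`: imports `RootDecomp1KHyper25` = the landed g15 parts; the verbatim g15
blocks `cvec`…`abs_dot_le`, `pmP`/`pmM`/`two_pow_hexp_succ`/`lambdaH_le_one`/`four_mul_two_pow_le_hexp_succ` are
DROPPED in favour of the tree's `HyperCell` declarations; §5d's plane-lemma block is still a copy — drop it when
`RootDecomp1KHyper26` lands; extra §6: placement against `HasRealQuadAnchor` and the COMBINED carve.)

Companion to the gen-15 node `QuadAnchor.lean` (real-quadratic-anchored cell, credited VERDICT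
L1540).  Residual attacked: the level-3 span residual of `RootDecomp1K.HyperLiouvilleSchanuel`
(stmt-Schanuel-33363),
`Rank3SpanResidual : ∀ z : Fin 3 → ℂ, ℚ-free → HyperLinLiouville z → ¬HasHLPairInSpan z → SB 3 z`
(`RootDecomp1KGaugeResidual`), whose points are the GENUINELY TERNARY hyper-Liouville triples.  The
critic's open class ℓ2 (K-R12): triples whose `ℤ`-span contains EXACTLY ONE algebraic line, e.g.
`(1, x, y)` with `x ∉ ℚ̄` — "any decided cell inside ℓ2 = one credit, lever necessarily new".

## The cells (X1, X2) and the theorem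

* `HasExpIntAnchor z`  : `span_ℤ(z) ∋ N₁` and `∋ N₂ e^{α}` with `N₁, N₂ ∈ ℤ ∖ 0`, `α ∈ ℚ̄ ∖ ℚ`;
* `HasExpPairAnchor z` : `span_ℤ(z) ∋ N₁ e^{α₁}, N₂ e^{α₂}`, `α₁, α₂ ∈ ℚ̄` ℚ-linearly independent;
* `HasExpLatAnchor := HasExpIntAnchor ∨ HasExpPairAnchor`.

**`sb_three_of_expLatAnchor (hLW : LWMeasure)`: a ℚ-free `HyperLinLiouville` triple with an
exponential-lattice anchor has Schanuel's bound `trdeg ℚ(z, e^z) ≥ 3`.**  X1 lies INSIDE ℓ2 whenever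
the span has no second algebraic line (e.g. every `(1, e^{α}, y)` below: `span ∩ ℚ̄ = ℤ`,
`eq_intCast_of_isAlgebraic_mem_span_latTriple`), so this decides a cell of ℓ2.  The carve:
`rank3SpanResidual_iff_expUnanchored (hLW) : Rank3SpanResidual ↔ (… → ¬HasExpLatAnchor z → SB 3 z)`,
and the two-cell carve `rank3SpanResidual_iff_of_cells` (instantiate with the g15 cell
`HasRealQuadAnchor` once `RootDecomp1KHyper22+` land) gives the new residual of record
`ℚ-free ∧ HLL ∧ ¬HLPair ∧ ¬RealQuadAnchor ∧ ¬ExpLatAnchor → SB 3 z`.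

## The lever (new relative to the tree and to g15)

AFFINE LATTICE EXTRACTION AT A TRANSCENDENTAL, MEASURED ANCHOR.  If `span_ℤ(z) ⊇ {w₁, w₂}` with
`wᵢ = Wᵢ(θ)` integer polynomials in an `MvPolyMeasure`d tuple `θ` (here `θ = (e^{N₁}, e^{α})` or
`(e^{α₁}, e^{α₂})`, measured by the LW/Ably measure `LWMeasure`), then
(§2) the measure yields a POLYNOMIAL LOWER BOUND `LatLB w₁ w₂` for the lattice `ℤw₁ + ℤw₂`
(Liouville's inequality with `ℚ(√D)` replaced by a transcendental lattice);
(§3) the hyper-small ternary forms of `z`, read through the `2 × 2` minors of the anchor's coefficient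
vectors, make some coordinate `z_j` HYPER-APPROXIMABLE from the lattice, `HyperLatApprox w₁ w₂ z_j`
(approximants `(A w₁ + B w₂)/E`);
(§1, THE ENGINE `no_int_relation_of_mvWeakMeasure_hyperLat`) a weakly measured `θ` admits NO
algebraic relation `Σ_k G_k(θ) y^k = 0` with a `y` hyper-approximable from a lattice inside `ℤ[θ]`:
specialise the relation at the approximant, clear `E`, and expand `(A W₁ + B W₂)^i` binomially — the
result is ONE integer polynomial `P = Σ c_{k,i} W₁^i W₂^{k−i} G_k E^{K−k}` in `θ` of controlled
degree and length (`mvcombo`, no norms, no conjugates, no resultants), non-zero at `θ` for large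
levels (isolation of the root `y` of the specialised one-variable polynomial), hence bounded below by
the weak measure — against the hyper-smallness: contradiction.  So `y ∉ ℚ̄(θ)`-alg, i.e.
`(y, θ)` algebraically independent, which with `#θ = 2` gives `trdeg ≥ 3`.

## Explicit members (the cell meets the residual's domain; ℓ2 is populated)

* §5b `z_E = (1, e^{−√2}, y_E)`, `y_E = Σ_k w_k 2^{−a_k}`, `w_k ∈ {1, e^{−√2}}` alternating,
  `a_{k+1} = 2^{(k+1)a_k}`: `HyperLatApprox`, `HyperLinLiouville`, anchored, genuinely ternary planted
  small forms at every level (all unconditional); ℚ-free, `span ∩ ℚ̄ = ℤ` (ℓ2) and `SB 3 z_E` mod LW.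
* §5c–§5f `z_C = (1, e^{i√2}, y_C)`, `y_C = y⁰ + e^{i√2} y¹`, `y⁰ = Σ_{k even} 2^{−a_k}`,
  `y¹ = Σ_{k odd} 2^{−a_k}`: additionally **`not_hasHLPairInSpan_zC : ¬HasHLPairInSpan z_C`
  UNCONDITIONALLY** — `(1, e^{i√2})` is an `ℝ`-basis of `ℂ`, so a real ratio of two span elements
  forces an integer relation among `(1, y⁰, y¹)`, which the PLANE LEMMA (lacunarity, g15 §6a verbatim)
  excludes; hence the ratio is rational, never hyper-Liouville.  `rank3SpanResidual_instance_zC (hLW)`: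
  `z_C` satisfies every hypothesis of `Rank3SpanResidual`, lies in ℓ2 and in X1, and `SB 3 z_C`.

## Conditionality, conventions, port plan

Everything "mod LW" carries the binder `(hLW : LWMeasure)` (the named Lindemann–Weierstrass/Ably
measure fact of `RootDecomp1KHyper04`; discharged by `Literature…LindemannWeierstrassMeasureHolds`,
whose import chain is currently stale on the farm — same convention as `mvPolyMeasure_exp_of_LW`).
No `sorry`, no axioms beyond `propext/Classical.choice/Quot.sound`, no instances/notation.
Sub-namespace `HyperCell.LatCell` (avoids clashes with the g15 names landing in `RootDecomp1KHyper21+`).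
Verbatim copies for the porter to dedupe: §3 `cvec`/`abs_cvec_le`/`abs_dot_le` (= g15 §4),
§5b `pmP`/`pmM`/`two_pow_hexp_succ`/`lambdaH_le_one`/`four_mul_two_pow_le_hexp_succ` and the three
private numeric lemmas (= g15 §5b), §5d `hKvec`/`Edef`/…/`eq_zero_of_Edef_eq_zero` (= g15 §6a).
Sources: Ably's measure / LW [Waldschmidt, *Diophantine approximation on linear algebraic groups*
(2000) §15; Nesterenko–Philippon LNM 1752 ch. 13–14], Brownawell 1979 (B14 in Chudnovsky 1984,
p. 32) for the "one Liouville-type coordinate" heuristic this cell makes precise at a lattice.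
-/

noncomputable section

open Complex IntermediateField Polynomial

namespace Summit.Schanuel.Schanuel.Theorems.RootDecomp1KHyper

namespace HyperCell

namespace LatCell

variable {n : ℕ}

/-! ## §1  Hyper-approximability from a lattice `ℤ w₁ + ℤ w₂` and the affine extraction engine -/

/-- **`HyperLatApprox w₁ w₂ y`**: the complex number `y` is hyper-approximable by the points
`(A w₁ + B w₂)/E` (`A, B ∈ ℤ`, `E ≥ 1`) of the ℚ-span of `w₁, w₂`: for every `m` some such point
`≠ y` lies within `exp(−(1 + E + |A| + |B|)^m)` of `y`. -/
def HyperLatApprox (w₁ w₂ y : ℂ) : Prop :=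
  ∀ m : ℕ, ∃ (A B : ℤ) (E : ℕ), 0 < E ∧ y ≠ ((A : ℂ) * w₁ + (B : ℂ) * w₂) / (E : ℂ) ∧
    ‖y - ((A : ℂ) * w₁ + (B : ℂ) * w₂) / (E : ℂ)‖ <
      Real.exp (-((1 + (E : ℝ) + |(A : ℝ)| + |(B : ℝ)|) ^ m))

/-- `exp(−x) ≤ 1/x` for `x > 0`. -/
private theorem exp_neg_le_one_div' {x : ℝ} (hx : 0 < x) : Real.exp (-x) ≤ 1 / x := by
  rw [Real.exp_neg, ← one_div]
  exact one_div_le_one_div_of_le hx (by linarith [Real.add_one_le_exp x])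

/-- Near a complex point `y`, a nonzero complex polynomial has no root other than (possibly) `y`. -/
private theorem exists_ball_eval_ne_zeroC (μ : ℂ[X]) (hμ : μ ≠ 0) (y : ℂ) :
    ∃ δ : ℝ, 0 < δ ∧ ∀ w : ℂ, w ≠ y → ‖w - y‖ < δ → μ.eval w ≠ 0 := by
  have hfin : {x : ℂ | μ.IsRoot x}.Finite := Polynomial.finite_setOf_isRoot hμ
  set T : Set ℂ := {x : ℂ | μ.IsRoot x} \ {y} with hT
  have hTfin : T.Finite := hfin.sdiff
  have hopen : Tᶜ ∈ nhds y := hTfin.isClosed.isOpen_compl.mem_nhds fun h => h.2 rfl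
  obtain ⟨δ, hδ, hball⟩ := Metric.mem_nhds_iff.mp hopen
  refine ⟨δ, hδ, fun w hw hwδ hroot => ?_⟩
  have hwT : w ∈ T := ⟨hroot, hw⟩
  have hwb : w ∈ Metric.ball y δ := by rw [Metric.mem_ball, dist_eq_norm]; exact hwδ
  exact hball hwb hwT

/-- Lipschitz bound at a complex root: `‖μ(w)‖ ≤ M ‖w − y‖` for `‖w − y‖ ≤ 1`. -/
private theorem exists_lipschitz_at_rootC (μ : ℂ[X]) (y : ℂ) (hroot : μ.eval y = 0) :
    ∃ M : ℝ, 0 < M ∧ ∀ w : ℂ, ‖w - y‖ ≤ 1 → ‖μ.eval w‖ ≤ M * ‖w - y‖ := by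
  set ν := μ /ₘ (X - C y) with hν
  have hdvd : (X - C y) * ν = μ := Polynomial.mul_divByMonic_eq_iff_isRoot.mpr hroot
  obtain ⟨M₀, hM₀⟩ := (isCompact_closedBall y 1).exists_bound_of_continuousOn
    (Polynomial.continuous ν).continuousOn
  refine ⟨max M₀ 0 + 1, by positivity, fun w hw => ?_⟩
  have hmem : w ∈ Metric.closedBall y 1 := by rw [Metric.mem_closedBall, dist_eq_norm]; exact hw
  have h1 : μ.eval w = (w - y) * ν.eval w := by
    conv_lhs => rw [← hdvd]
    rw [eval_mul, eval_sub, eval_X, eval_C]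
  rw [h1, norm_mul]
  calc ‖w - y‖ * ‖ν.eval w‖ ≤ ‖w - y‖ * M₀ := by gcongr; exact hM₀ _ hmem
    _ ≤ ‖w - y‖ * (max M₀ 0 + 1) := by gcongr; linarith [le_max_left M₀ 0]
    _ = (max M₀ 0 + 1) * ‖w - y‖ := mul_comm _ _

/-- The binomial sum over `Fin (K+1)` with the vanishing binomial coefficients beyond `k`. -/
private theorem sum_fin_choose_eq_add_pow {R : Type*} [CommRing R] {K : ℕ} (k : Fin (K + 1)) (u v : R) :
    ∑ i : Fin (K + 1), ((Nat.choose k i : ℕ) : R) * u ^ (i : ℕ) * v ^ ((k : ℕ) - i) =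
      (u + v) ^ (k : ℕ) := by
  have hk : (k : ℕ) + 1 ≤ K + 1 := Nat.succ_le_succ (Nat.lt_succ_iff.mp k.2)
  rw [Fin.sum_univ_eq_sum_range (fun i => ((Nat.choose k i : ℕ) : R) * u ^ i * v ^ ((k : ℕ) - i))
    (K + 1), add_pow]
  symm
  rw [← Finset.sum_subset (Finset.range_subset_range.mpr hk)]
  · exact Finset.sum_congr rfl fun i _ => by ring
  · intro i _ hi
    have hlt : (k : ℕ) < i := by
      rw [Finset.mem_range] at hi; omega
    rw [Nat.choose_eq_zero_of_lt hlt]; simp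

set_option maxHeartbeats 1600000 in
/-- **Affine (lattice) extraction engine in several variables (kernel).**  No relation
`Σ_{k ≤ K} G_k(θ) y^k = 0`, `G_k ∈ ℤ[X₁, …, Xₙ]` not all zero, between a tuple `θ` with an
`MvWeakMeasure` and a number `y` hyper-approximable from the lattice `ℤ W₁(θ) + ℤ W₂(θ)`,
`W₁, W₂ ∈ ℤ[X₁, …, Xₙ]` fixed.  The homogenised specialisation
`P = Σ_{k,i} C(k,i) A^i B^{k−i} E^{K−k} · W₁^i W₂^{k−i} G_k` has `P(θ) = E^K μ(β) ≠ 0`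
(`β = (A W₁(θ) + B W₂(θ))/E` in a punctured ball about the root `y` of `μ = Σ G_k(θ) Y^k`),
length polynomial and value hyper-small in the height — against the measure. -/
theorem no_int_relation_of_mvWeakMeasure_hyperLat {n : ℕ} {θ : Fin n → ℂ}
    (hθ : MvWeakMeasure θ) (W₁ W₂ : MvPolynomial (Fin n) ℤ) {y : ℂ}
    (hy : HyperLatApprox (MvPolynomial.aeval θ W₁) (MvPolynomial.aeval θ W₂) y) {K : ℕ}
    (G : Fin (K + 1) → MvPolynomial (Fin n) ℤ) (hG : ∃ k, G k ≠ 0)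
    (hrel : ∑ k : Fin (K + 1), MvPolynomial.aeval θ (G k) * y ^ (k : ℕ) = 0) : False := by
  -- the complex polynomial μ(Y) = Σ_k G_k(θ) Y^k
  set μ : ℂ[X] := ∑ k : Fin (K + 1), C (MvPolynomial.aeval θ (G k)) * X ^ (k : ℕ) with hμdef
  have hμeval : ∀ w : ℂ, μ.eval w =
      ∑ k : Fin (K + 1), MvPolynomial.aeval θ (G k) * w ^ (k : ℕ) := by
    intro w
    simp only [hμdef, eval_finsetSum, eval_mul, eval_C, eval_pow, eval_X]
  have hμcoeff : ∀ k : Fin (K + 1), μ.coeff k = MvPolynomial.aeval θ (G k) := by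
    intro k
    simp only [hμdef, finsetSum_coeff, coeff_C_mul, coeff_X_pow]
    rw [Finset.sum_eq_single k]
    · simp
    · intro j _ hjk
      have : (k : ℕ) ≠ (j : ℕ) := fun h => hjk (Fin.ext h).symm
      simp [this]
    · intro h; exact absurd (Finset.mem_univ k) h
  have hμ0 : μ ≠ 0 := by
    obtain ⟨k, hk⟩ := hG
    intro h0
    have h1 : μ.coeff k = 0 := by rw [h0, coeff_zero]
    rw [hμcoeff] at h1
    exact mvaeval_ne_zero_of_mvWeakMeasure hθ hk h1
  have hroot : μ.eval y = 0 := by rw [hμeval]; exact hrel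
  obtain ⟨δ, hδ, hδroot⟩ := exists_ball_eval_ne_zeroC μ hμ0 y
  obtain ⟨L, hL, hLip⟩ := exists_lipschitz_at_rootC μ y hroot
  -- degrees, the measure, the fixed polynomials W₁^i W₂^{k-i} G_k
  set w₁ : ℂ := MvPolynomial.aeval θ W₁ with hw₁
  set w₂ : ℂ := MvPolynomial.aeval θ W₂ with hw₂
  set Dg : ℕ := Finset.univ.sup fun k : Fin (K + 1) => (G k).totalDegree with hDgdef
  have hDg : ∀ k, (G k).totalDegree ≤ Dg := fun k =>
    Finset.le_sup (f := fun k : Fin (K + 1) => (G k).totalDegree) (Finset.mem_univ k)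
  set Dt : ℕ := K * W₁.totalDegree + K * W₂.totalDegree + Dg with hDtdef
  obtain ⟨Cm, kk, hCm, hmeas⟩ := hθ Dt
  set FF : Fin (K + 1) × Fin (K + 1) → MvPolynomial (Fin n) ℤ :=
    fun ki => W₁ ^ (ki.2 : ℕ) * W₂ ^ ((ki.1 : ℕ) - ki.2) * G ki.1 with hFFdef
  have hFFdeg : ∀ ki, (FF ki).totalDegree ≤ Dt := by
    intro ki
    have hi : (ki.2 : ℕ) ≤ K := Nat.lt_succ_iff.mp ki.2.2
    have hk : (ki.1 : ℕ) - ki.2 ≤ K := (Nat.sub_le _ _).trans (Nat.lt_succ_iff.mp ki.1.2)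
    calc (FF ki).totalDegree
        ≤ (W₁ ^ (ki.2 : ℕ) * W₂ ^ ((ki.1 : ℕ) - ki.2)).totalDegree + (G ki.1).totalDegree :=
          MvPolynomial.totalDegree_mul _ _
      _ ≤ ((W₁ ^ (ki.2 : ℕ)).totalDegree + (W₂ ^ ((ki.1 : ℕ) - ki.2)).totalDegree) + Dg :=
          add_le_add (MvPolynomial.totalDegree_mul _ _) (hDg _)
      _ ≤ ((ki.2 : ℕ) * W₁.totalDegree + ((ki.1 : ℕ) - ki.2) * W₂.totalDegree) + Dg :=
          add_le_add (add_le_add (MvPolynomial.totalDegree_pow _ _)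
            (MvPolynomial.totalDegree_pow _ _)) le_rfl
      _ ≤ (K * W₁.totalDegree + K * W₂.totalDegree) + Dg :=
          add_le_add (add_le_add (Nat.mul_le_mul_right _ hi) (Nat.mul_le_mul_right _ hk)) le_rfl
      _ = Dt := by rw [hDtdef]
  set Λ : ℤ := ∑ ki, mvlen (FF ki) with hΛdef
  have hΛ : 0 ≤ Λ := Finset.sum_nonneg fun _ _ => mvlen_nonneg _
  have hΛR : (0 : ℝ) ≤ ((Λ : ℤ) : ℝ) := by exact_mod_cast hΛ
  -- constants
  set c₁ : ℝ := Cm * ((Λ : ℤ) : ℝ) ^ kk with hc₁def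
  set c₂ : ℝ := L with hc₂def
  have hc₁ : 0 ≤ c₁ := by positivity
  have hc₂ : 0 ≤ c₂ := hL.le
  set e₁ : ℕ := 4 * K * kk with he₁
  set N : ℕ := ⌈c₁ + c₂ + δ⁻¹⌉₊ + 1 with hNdef
  set m : ℕ := e₁ + K + N with hmdef
  have hδinv : 0 < δ⁻¹ := inv_pos.mpr hδ
  have hNgt : c₁ + c₂ + δ⁻¹ < N := by
    have h1 : c₁ + c₂ + δ⁻¹ ≤ ⌈c₁ + c₂ + δ⁻¹⌉₊ := Nat.le_ceil _
    rw [hNdef]; push_cast; linarith only [h1]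
  have hN2 : (N : ℝ) ≤ (2 : ℝ) ^ N := by
    have h := (Nat.lt_two_pow_self (n := N)).le
    have h' : ((N : ℕ) : ℝ) ≤ ((2 ^ N : ℕ) : ℝ) := Nat.cast_le.mpr h
    simpa using h'
  -- the approximation
  obtain ⟨A, B, E, hE, hne, hlt⟩ := hy m
  have hE1 : (1 : ℝ) ≤ E := by exact_mod_cast hE
  have hEpos : (0 : ℝ) < E := by exact_mod_cast hE
  have hE0 : E ≠ 0 := by omega
  have hEC : (E : ℂ) ≠ 0 := by exact_mod_cast hE0
  set Xr : ℝ := 1 + (E : ℝ) + |(A : ℝ)| + |(B : ℝ)| with hXdef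
  have hX2 : 2 ≤ Xr := by
    rw [hXdef]; linarith only [hE1, abs_nonneg (A : ℝ), abs_nonneg (B : ℝ)]
  have hX1 : 1 ≤ Xr := by linarith only [hX2]
  have hX0 : 0 < Xr := by linarith only [hX2]
  have hEX : (E : ℝ) ≤ Xr := by
    rw [hXdef]; linarith only [abs_nonneg (A : ℝ), abs_nonneg (B : ℝ)]
  have hAX : |(A : ℝ)| ≤ Xr := by rw [hXdef]; linarith only [hEpos, abs_nonneg (B : ℝ)]
  have hBX : |(B : ℝ)| ≤ Xr := by rw [hXdef]; linarith only [hEpos, abs_nonneg (A : ℝ)]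
  set β : ℂ := ((A : ℂ) * w₁ + (B : ℂ) * w₂) / (E : ℂ) with hβdef
  set ε : ℝ := Real.exp (-(Xr ^ m)) with hεdef
  have hε0 : 0 < ε := Real.exp_pos _
  have hXe : ∀ e : ℕ, 1 ≤ Xr ^ e := fun e => one_le_pow₀ hX1
  have hXm : Xr ^ m = Xr ^ N * Xr ^ e₁ * Xr ^ K := by rw [hmdef, pow_add, pow_add]; ring
  have hXN : (N : ℝ) ≤ Xr ^ N := hN2.trans (pow_le_pow_left₀ (by norm_num) hX2 N)
  have hXm_gt : δ⁻¹ < Xr ^ m := by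
    have h1 : Xr ^ N ≤ Xr ^ m := by
      rw [hXm]
      calc Xr ^ N = Xr ^ N * 1 * 1 := by ring
        _ ≤ Xr ^ N * Xr ^ e₁ * Xr ^ K := by gcongr <;> exact hXe _
    linarith only [h1, hXN, hNgt, hc₁, hc₂]
  have hεδ : ε < δ := by
    calc ε < Real.exp (-δ⁻¹) := Real.exp_lt_exp.mpr (by linarith only [hXm_gt])
      _ ≤ 1 / δ⁻¹ := exp_neg_le_one_div' hδinv
      _ = δ := by rw [one_div, inv_inv]
  have hε1 : ε ≤ 1 := by
    rw [hεdef]; exact Real.exp_le_one_iff.mpr (by linarith only [hXe m])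
  have hyβ : ‖β - y‖ < ε := by rw [norm_sub_rev]; exact hlt
  have hyβ1 : ‖β - y‖ ≤ 1 := by linarith only [hyβ, hε1]
  have hyβδ : ‖β - y‖ < δ := by linarith only [hyβ, hεδ]
  have hβne : β ≠ y := fun h => hne h.symm
  -- (1) μ(β) ≠ 0 and the Lipschitz bound
  have hμβ : μ.eval β ≠ 0 := hδroot β hβne hyβδ
  have hμβle : ‖μ.eval β‖ ≤ L * ε :=
    (hLip β hyβ1).trans (mul_le_mul_of_nonneg_left hyβ.le hL.le)
  -- (2) the integer polynomial P (homogenised binomial specialisation)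
  set cc : Fin (K + 1) × Fin (K + 1) → ℤ := fun ki =>
    (Nat.choose ki.1 ki.2 : ℤ) * A ^ (ki.2 : ℕ) * B ^ ((ki.1 : ℕ) - ki.2) * (E : ℤ) ^ (K - ki.1)
    with hccdef
  set P : MvPolynomial (Fin n) ℤ := mvcombo cc FF with hPdef
  have hsplit : ∀ k : Fin (K + 1), (E : ℂ) ^ K = (E : ℂ) ^ (k : ℕ) * (E : ℂ) ^ (K - k) := by
    intro k
    rw [← pow_add, Nat.add_sub_of_le (Nat.lt_succ_iff.mp k.2)]
  have hEinv : ∀ k : Fin (K + 1), (E : ℂ) ^ (k : ℕ) * ((E : ℂ) ^ (k : ℕ))⁻¹ = 1 := fun k =>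
    mul_inv_cancel₀ (pow_ne_zero _ hEC)
  have hPe : MvPolynomial.aeval θ P = (E : ℂ) ^ K * μ.eval β := by
    rw [hPdef, aeval_mvcombo, hμeval, Finset.mul_sum, Fintype.sum_prod_type]
    refine Finset.sum_congr rfl fun k _ => ?_
    have hbin := sum_fin_choose_eq_add_pow (R := ℂ) k ((A : ℂ) * w₁) ((B : ℂ) * w₂)
    have hk1 : ∑ i : Fin (K + 1), ((cc (k, i) : ℤ) : ℂ) * MvPolynomial.aeval θ (FF (k, i)) =
        (E : ℂ) ^ (K - k) * MvPolynomial.aeval θ (G k) *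
          ∑ i : Fin (K + 1), ((Nat.choose k i : ℕ) : ℂ) * ((A : ℂ) * w₁) ^ (i : ℕ) *
            ((B : ℂ) * w₂) ^ ((k : ℕ) - i) := by
      rw [Finset.mul_sum]
      refine Finset.sum_congr rfl fun i _ => ?_
      simp only [hccdef, hFFdef, map_mul, map_pow, ← hw₁, ← hw₂]
      push_cast
      ring
    rw [hk1, hbin, hβdef, div_pow, hsplit k, div_eq_mul_inv]
    linear_combination (-((E : ℂ) ^ (K - k) * MvPolynomial.aeval θ (G k) *
      ((A : ℂ) * w₁ + (B : ℂ) * w₂) ^ (k : ℕ))) * hEinv k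
  -- (3) P ≠ 0
  have hP0 : P ≠ 0 := by
    intro h0
    have h1 : (E : ℂ) ^ K * μ.eval β = 0 := by rw [← hPe, h0, map_zero]
    rcases mul_eq_zero.mp h1 with h | h
    · exact pow_ne_zero K hEC h
    · exact hμβ h
  -- (4) upper bound ‖P(θ)‖ ≤ c₂ X^K ε
  have hup : ‖MvPolynomial.aeval θ P‖ ≤ c₂ * Xr ^ K * ε := by
    rw [hPe, norm_mul, norm_pow, Complex.norm_natCast]
    calc (E : ℝ) ^ K * ‖μ.eval β‖ ≤ Xr ^ K * (L * ε) := by gcongr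
      _ = c₂ * Xr ^ K * ε := by rw [hc₂def]; ring
  -- (5) lower bound from the measure: degree and length of P
  have hdegP : P.totalDegree ≤ Dt := by rw [hPdef]; exact totalDegree_mvcombo_le cc FF hFFdeg
  set Bc : ℝ := Xr ^ (4 * K) with hBcdef
  have hpowK : ∀ (t : ℝ), 0 ≤ t → t ≤ Xr → ∀ e : ℕ, e ≤ K → t ^ e ≤ Xr ^ K := by
    intro t ht htX e he
    calc t ^ e ≤ Xr ^ e := pow_le_pow_left₀ ht htX e
      _ ≤ Xr ^ K := pow_le_pow_right₀ hX1 he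
  have hccle : ∀ ki, |((cc ki : ℤ) : ℝ)| ≤ Bc := by
    intro ki
    have hk : (ki.1 : ℕ) ≤ K := Nat.lt_succ_iff.mp ki.1.2
    have hi : (ki.2 : ℕ) ≤ K := Nat.lt_succ_iff.mp ki.2.2
    have hchoose : ((Nat.choose ki.1 ki.2 : ℕ) : ℝ) ≤ Xr ^ K := by
      have h1 : ((Nat.choose ki.1 ki.2 : ℕ) : ℝ) ≤ ((2 ^ (ki.1 : ℕ) : ℕ) : ℝ) :=
        Nat.cast_le.mpr (Nat.choose_le_two_pow _ _)
      have h2 : ((2 ^ (ki.1 : ℕ) : ℕ) : ℝ) = (2 : ℝ) ^ (ki.1 : ℕ) := by push_cast; ring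
      rw [h2] at h1
      exact h1.trans (hpowK 2 (by norm_num) hX2 _ hk)
    simp only [hccdef, Int.cast_mul, Int.cast_pow, Int.cast_natCast, abs_mul, abs_pow,
      Nat.abs_cast]
    calc ((Nat.choose ki.1 ki.2 : ℕ) : ℝ) * |(A : ℝ)| ^ (ki.2 : ℕ) *
          |(B : ℝ)| ^ ((ki.1 : ℕ) - ki.2) * (E : ℝ) ^ (K - ki.1)
        ≤ Xr ^ K * Xr ^ K * Xr ^ K * Xr ^ K := by
          refine mul_le_mul (mul_le_mul (mul_le_mul hchoose
            (hpowK _ (abs_nonneg _) hAX _ hi) (by positivity) (by positivity))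
            (hpowK _ (abs_nonneg _) hBX _ ((Nat.sub_le _ _).trans hk)) (by positivity)
            (by positivity)) (hpowK _ hEpos.le hEX _ (Nat.sub_le _ _)) (by positivity)
            (by positivity)
      _ = Bc := by rw [hBcdef]; ring
  have hlenP : ((mvlen P : ℤ) : ℝ) ≤ Bc * ((Λ : ℤ) : ℝ) := by
    have h1 : ((mvlen P : ℤ) : ℝ) ≤ ((∑ ki, |cc ki| * mvlen (FF ki) : ℤ) : ℝ) := by
      rw [hPdef]; exact_mod_cast mvlen_mvcombo_le cc FF
    refine h1.trans ?_
    rw [hΛdef]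
    push_cast
    rw [Finset.mul_sum]
    refine Finset.sum_le_sum fun ki _ => ?_
    exact mul_le_mul_of_nonneg_right (hccle ki) (by exact_mod_cast mvlen_nonneg _)
  have hlen0 : (0 : ℝ) ≤ ((mvlen P : ℤ) : ℝ) := by exact_mod_cast mvlen_nonneg P
  have hlow : Real.exp (-(Cm * ((mvlen P : ℤ) : ℝ) ^ kk)) ≤ ‖MvPolynomial.aeval θ P‖ :=
    hmeas P hP0 hdegP
  have hc₁X : Cm * ((mvlen P : ℤ) : ℝ) ^ kk ≤ c₁ * Xr ^ e₁ := by
    have h1 : ((mvlen P : ℤ) : ℝ) ^ kk ≤ (Bc * ((Λ : ℤ) : ℝ)) ^ kk :=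
      pow_le_pow_left₀ hlen0 hlenP kk
    have h2 : (Bc * ((Λ : ℤ) : ℝ)) ^ kk = ((Λ : ℤ) : ℝ) ^ kk * Xr ^ e₁ := by
      rw [hBcdef, he₁, pow_mul Xr (4 * K) kk, mul_pow]; ring
    calc Cm * ((mvlen P : ℤ) : ℝ) ^ kk ≤ Cm * (Bc * ((Λ : ℤ) : ℝ)) ^ kk :=
          mul_le_mul_of_nonneg_left h1 hCm.le
      _ = c₁ * Xr ^ e₁ := by rw [h2, hc₁def]; ring
  have hlow' : Real.exp (-(c₁ * Xr ^ e₁)) ≤ ‖MvPolynomial.aeval θ P‖ :=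
    (Real.exp_le_exp.mpr (neg_le_neg hc₁X)).trans hlow
  -- (6) the clash
  have hchain : Real.exp (-(c₁ * Xr ^ e₁)) ≤ c₂ * Xr ^ K * ε := hlow'.trans hup
  have hmain : c₁ * Xr ^ e₁ + c₂ * Xr ^ K ≤ Xr ^ m := by
    rw [hXm]
    have h1 : c₁ * Xr ^ e₁ ≤ c₁ * (Xr ^ e₁ * Xr ^ K) := by
      apply mul_le_mul_of_nonneg_left _ hc₁
      calc Xr ^ e₁ = Xr ^ e₁ * 1 := (mul_one _).symm
        _ ≤ Xr ^ e₁ * Xr ^ K := by gcongr; exact hXe _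
    have h2 : c₂ * Xr ^ K ≤ c₂ * (Xr ^ e₁ * Xr ^ K) := by
      apply mul_le_mul_of_nonneg_left _ hc₂
      calc Xr ^ K = 1 * Xr ^ K := (one_mul _).symm
        _ ≤ Xr ^ e₁ * Xr ^ K := by gcongr; exact hXe _
    have h3 : c₁ + c₂ ≤ Xr ^ N := by linarith only [hNgt, hXN, hδinv]
    calc c₁ * Xr ^ e₁ + c₂ * Xr ^ K
        ≤ c₁ * (Xr ^ e₁ * Xr ^ K) + c₂ * (Xr ^ e₁ * Xr ^ K) := add_le_add h1 h2
      _ = (c₁ + c₂) * (Xr ^ e₁ * Xr ^ K) := by ring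
      _ ≤ Xr ^ N * (Xr ^ e₁ * Xr ^ K) := mul_le_mul_of_nonneg_right h3 (by positivity)
      _ = Xr ^ N * Xr ^ e₁ * Xr ^ K := by ring
  have hlt2 : c₂ * Xr ^ K * ε < Real.exp (-(c₁ * Xr ^ e₁)) := by
    have h1 : c₂ * Xr ^ K < Real.exp (Xr ^ m - c₁ * Xr ^ e₁) := by
      have h2 := Real.add_one_le_exp (Xr ^ m - c₁ * Xr ^ e₁)
      linarith only [h2, hmain]
    have h3 : Real.exp (Xr ^ m - c₁ * Xr ^ e₁) * ε = Real.exp (-(c₁ * Xr ^ e₁)) := by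
      rw [hεdef, ← Real.exp_add]; congr 1; ring
    calc c₂ * Xr ^ K * ε < Real.exp (Xr ^ m - c₁ * Xr ^ e₁) * ε :=
          mul_lt_mul_of_pos_right h1 hε0
      _ = Real.exp (-(c₁ * Xr ^ e₁)) := h3
  exact absurd hchain (not_le.mpr hlt2)

end LatCell

end HyperCell

end Summit.Schanuel.Schanuel.Theorems.RootDecomp1KHyper
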